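import Literature.NumberTheory.Transcendental.SemistabilityStdOfEngine
import Literature.NumberTheory.Transcendental.BakerNumericsG
import Literature.NumberTheory.Transcendental.PhilipponZeroEstimateStdProofs
import HarnessLib

/-!
# The Semistability Theorem for `M_κ` at all algebraic points from Philippon's zero estimate

Topic: `Literature/NumberTheory/Transcendental`. A proofs-only file (theorems only) of the unit
`provefact-Literature.NumberTheory.Transcendental.s-efcbe22610` (fact
`Literature.NumberTheory.Transcendental.semistabilityTheorem_std`, Baker–Wüstholz,
*Logarithmic Forms and Diophantine Geometry*, Thm. 6.15, for the explicit group varieties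
`M_κ = 𝔾ₘ^β × P_κ`, every proper semistable `ℚ̄`-rational `𝔟`, at EVERY algebraic point).

`SemistabilityStdOfEngine.lean` reduced `semistabilityTheorem_std` to Philippon's zero estimate
(`philippon1986_std`) and the ENGINE OUTPUT of Baker's method at all algebraic points; the
torsion-point chain delivers the latter at points with torsion abelian part. The general-point
chain `BakerFieldG` → `BakerSiegelG` → `ThetaBaseLowerBoundG` → `BakerNewPointsG` →
`BakerNumericsG` (heights of the multiples `s·v` of a general algebraic point, the scaled engine
`BakerDataG.engine₂` and its admissible exponential parameters `admissibleParamsG_of_lt`) delivers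
it at every REDUCED algebraic point (each `E`-coordinate a lattice vector or without torsion), and
every algebraic point has a reduced multiple. This file assembles:

* `Std.engine_of_reduced` — the engine output at a reduced point `w ∈ 𝔟 ∩ Std.Alg`,
  `0 < dim 𝔟 < n`, for every `c > 0` (`exists_bakerDataG` + `admissibleParamsG_of_lt` + `engine₂`);
* `Std.mem_ker_of_stable_algR` — the stable case at an ARBITRARY algebraic point: run the first
  run at a reduced multiple `N·w` (`dichotomy_of_engine`); by stability the obstruction has
  `Lie K = 0`, so `rN·w ∈ ker`, `w` has torsion abelian part, and the landed second run
  (`torsionDichotomy`) closes;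
* `Std.mem_ker_of_semistable_card_algR` — the induction over borderline quotients and subgroups
  (`SemistabilityStdOfEngine.mem_ker_of_semistable_card_alg` verbatim, with the engine hypothesis
  restricted to reduced points);
* **`semistabilityTheorem_std_of_philippon : philippon1986_std → semistabilityTheorem_std`** and its
  corollaries through the landed reductions (`analyticSubgroupTheorem_GaGmE_of_philippon`, the
  unrestricted hyperplane form);
* **`semistabilityTheorem_std_holds : semistabilityTheorem_std`** — the DISCHARGE of the named
  fact: `semistabilityTheorem_std_of_philippon` applied to the theorem `philippon1986_std_holds`
  (Philippon 1986, Thm. 2.1, on `M_κ`, `PhilipponZeroEstimateStdProofs.lean`); nothing else is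
  assumed.

## References

* A. Baker, G. Wüstholz, *Logarithmic Forms and Diophantine Geometry*, New Math. Monogr. 9, CUP
  2007, Thm. 6.15, §6.8 (pp. 115–119). [BakerWustholz2007]
* P. Philippon, *Lemmes de zéros dans les groupes algébriques commutatifs*, Bull. Soc. Math.
  France 114 (1986), Thm. 2.1. [Philippon1986]
-/

noncomputable section

open Module Submodule Complex
open scoped PeriodPair

namespace Literature.NumberTheory.Transcendental

namespace GaGmE

namespace Std

open LiePresentation

variable {β γ δ : Type} [Fintype β] [Fintype γ] [Fintype δ]

/-! ### The engine output at reduced algebraic points -/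

/-- **The general-point engine delivers the engine output at reduced points**: at a reduced point
`w ∈ 𝔟 ∩ Std.Alg` of a `ℚ̄`-rational proper `𝔟` with `0 < dim 𝔟`, for every `c > 0` the Baker
engine (`BakerDataG.engine₂` with the parameters of `BakerDataG.admissibleParamsG_of_lt`) produces a
form as in the hypothesis of `dichotomy_of_engine`. [cite: BakerWustholz2007, §6.8 (pp. 117–119)] -/
theorem engine_of_reduced [DecidableEq γ] [DecidableEq β] [DecidableEq δ] (L : PeriodPair)
    (h₂ : IsAlgebraic ℚ L.g₂) (h₃ : IsAlgebraic ℚ L.g₃) (κM : δ → γ → Kbar)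
    {𝔟 : Submodule ℂ (β ⊕ (γ ⊕ δ) → ℂ)} (hrat : IsKRational Kbar 𝔟) (h𝔟 : 𝔟 ≠ ⊤)
    {w : β ⊕ (γ ⊕ δ) → ℂ} (hw𝔟 : w ∈ 𝔟) (hw : w ∈ Alg L κM)
    (hred : ∀ b, w (iz b) ∈ L.lattice ∨ ∀ s : ℕ, s ≠ 0 → (s : ℂ) * w (iz b) ∉ L.lattice)
    {c : ℝ} (hc : 0 < c) :
    ∃ (D S T : ℕ) (P : MvPolynomial (Option β × ThetaIdx γ δ) ℂ), 1 ≤ D ∧ 1 ≤ S ∧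
      P.IsHomogeneous D ∧ (∃ w', thetaEval L κM P w' ≠ 0) ∧
      (∀ s : ℕ, s ≤ Fintype.card (β ⊕ (γ ⊕ δ)) * S →
        VanishesAlong 𝔟 (thetaEval L κM P) ((s : ℂ) • w) (Fintype.card (β ⊕ (γ ⊕ δ)) * T + 1)) ∧
      ∀ e m : ℕ, m < Fintype.card (β ⊕ (γ ⊕ δ)) →
        Module.finrank ℂ 𝔟 * (Fintype.card (β ⊕ (γ ⊕ δ)) - m) ≤ e * Fintype.card (β ⊕ (γ ⊕ δ)) →
        c * (D : ℝ) ^ Fintype.card (β ⊕ (γ ⊕ δ)) < (Nat.choose (T + e) e : ℝ) * ((S : ℝ) + 1) * (D : ℝ) ^ m ∧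
        (Module.finrank ℂ 𝔟 * (Fintype.card (β ⊕ (γ ⊕ δ)) - m) < e * Fintype.card (β ⊕ (γ ⊕ δ)) →
          c * (D : ℝ) ^ Fintype.card (β ⊕ (γ ⊕ δ)) < (Nat.choose (T + e) e : ℝ) * (D : ℝ) ^ m) := by
  set n := Fintype.card (β ⊕ (γ ⊕ δ)) with hn
  have h𝔟lt : Module.finrank ℂ 𝔟 < n := by
    have := Submodule.finrank_lt h𝔟; simpa [hn] using this
  -- the Baker datum and admissible parameters
  obtain ⟨B, hBL, hBκ, hBv, hBdd, hBspan⟩ := exists_bakerDataG L h₂ h₃ κM hrat hw hred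
  have hdd : B.dd < Fintype.card (β ⊕ (γ ⊕ δ)) := by rw [hBdd]; exact h𝔟lt
  obtain ⟨D', T, S₀, S, T'', R, hT, hD', hS, hpq, hR0, hR, hnum, hineq⟩ := B.admissibleParamsG_of_lt hdd hc
  -- run the engine
  have hv : B.v ∈ B.bSpan := by
    show B.v ∈ Submodule.span ℂ (Set.range B.xs)
    rw [hBspan, hBv]; exact hw𝔟
  obtain ⟨P, hP, hne, hvan⟩ := B.engine₂ hv D' T S₀ (n * S) (n * T'' + 1) R hT hpq hR0 (by exact_mod_cast hR) hnum
  have hD1 : 1 ≤ n * D' := Nat.one_le_iff_ne_zero.mpr (Nat.mul_ne_zero (by omega) (by omega))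
  refine ⟨n * D', S, T'', P, hD1, hS, hP, ?_, ?_, ?_⟩
  · rwa [hBL, hBκ] at hne
  · intro s hs
    have := hvan s hs
    rwa [show B.bSpan = 𝔟 from hBspan, hBL, hBκ, hBv] at this
  · intro e m hm hidx
    have hm' : m < Fintype.card (β ⊕ (γ ⊕ δ)) := hn ▸ hm
    have hidx' : B.dd * (Fintype.card (β ⊕ (γ ⊕ δ)) - m) ≤ e * Fintype.card (β ⊕ (γ ⊕ δ)) := by
      rw [hBdd, ← hn]; exact hidx
    have := hineq e m hm' hidx'
    rw [hBdd, ← hn] at this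
    exact this

/-! ### The stable case at all algebraic points -/

/-- **The Semistability Theorem for a STABLE `𝔟` at ALL algebraic points** (modulo Philippon's zero
estimate and the engine output at the REDUCED algebraic points of `𝔟`). Let `Λ` have algebraic
invariants and no CM, `𝔟 ⊊ Lie M_κ` `ℚ̄`-rational and semistable with no borderline `0 ≠ K ≠ M_κ`,
and `w ∈ 𝔟` with `exp(w)` algebraic. Then `w ∈ ker(exp)`: a multiple `N·w` (`N ≥ 1`) is reduced
(`exists_reduced_multiple`); the first run at `N·w` (`dichotomy_of_engine`) gives a borderline
obstruction `K` over `ℂ` with `r·N·w ∈ Lie K + ker`; by stability `Lie K = 0`, so `rN·w ∈ ker`, `w`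
has TORSION abelian part, and the landed second run `torsionDichotomy` closes.
[cite: BakerWustholz2007, Thm. 6.15, §6.8 (pp. 116–119)] -/
theorem mem_ker_of_stable_algR [DecidableEq γ] [DecidableEq β] [DecidableEq δ] (hphil : philippon1986_std)
    (L : PeriodPair) (h₂ : IsAlgebraic ℚ L.g₂) (h₃ : IsAlgebraic ℚ L.g₃) (hCM : ¬ L.HasCM)
    (κM : δ → γ → Kbar)
    {𝔟 : Submodule ℂ (β ⊕ (γ ⊕ δ) → ℂ)} (hrat : IsKRational Kbar 𝔟) (h𝔟 : 𝔟 ≠ ⊤)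
    (hss : Semistable κM 𝔟)
    (hst : ∀ D : SubgroupData β γ δ κM, D.tangent ≠ ⊤ → D.tangent ≠ ⊥ →
      Module.finrank ℂ 𝔟 * (Fintype.card (β ⊕ (γ ⊕ δ)) - Module.finrank ℂ D.tangent) ≠
        (Module.finrank ℂ 𝔟 - Module.finrank ℂ ↥(𝔟 ⊓ D.tangent)) * Fintype.card (β ⊕ (γ ⊕ δ)))
    {w : β ⊕ (γ ⊕ δ) → ℂ} (hw𝔟 : w ∈ 𝔟) (hw : w ∈ Alg L κM)
    (heng : ∀ w' ∈ 𝔟, w' ∈ Alg L κM →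
      (∀ b, w' (iz b) ∈ L.lattice ∨ ∀ s : ℕ, s ≠ 0 → (s : ℂ) * w' (iz b) ∉ L.lattice) →
      0 < Module.finrank ℂ 𝔟 → ∀ c : ℝ, 0 < c →
      ∃ (D S T : ℕ) (P : MvPolynomial (Option β × ThetaIdx γ δ) ℂ), 1 ≤ D ∧ 1 ≤ S ∧
        P.IsHomogeneous D ∧ (∃ w'', thetaEval L κM P w'' ≠ 0) ∧
        (∀ s : ℕ, s ≤ Fintype.card (β ⊕ (γ ⊕ δ)) * S →
          VanishesAlong 𝔟 (thetaEval L κM P) ((s : ℂ) • w') (Fintype.card (β ⊕ (γ ⊕ δ)) * T + 1)) ∧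
        ∀ e m : ℕ, m < Fintype.card (β ⊕ (γ ⊕ δ)) →
          Module.finrank ℂ 𝔟 * (Fintype.card (β ⊕ (γ ⊕ δ)) - m) ≤ e * Fintype.card (β ⊕ (γ ⊕ δ)) →
          c * (D : ℝ) ^ Fintype.card (β ⊕ (γ ⊕ δ)) < (Nat.choose (T + e) e : ℝ) * ((S : ℝ) + 1) * (D : ℝ) ^ m ∧
          (Module.finrank ℂ 𝔟 * (Fintype.card (β ⊕ (γ ⊕ δ)) - m) < e * Fintype.card (β ⊕ (γ ⊕ δ)) →
            c * (D : ℝ) ^ Fintype.card (β ⊕ (γ ⊕ δ)) < (Nat.choose (T + e) e : ℝ) * (D : ℝ) ^ m)) :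
    w ∈ ker L κM := by
  by_contra hwker
  -- a reduced multiple `N·w`
  obtain ⟨N, hN, hred⟩ := exists_reduced_multiple L w
  have hNw𝔟 : (N : ℂ) • w ∈ 𝔟 := Submodule.smul_mem _ _ hw𝔟
  have hNw : (N : ℂ) • w ∈ Alg L κM := nsmul_mem_Alg κM h₂ h₃ hw N
  -- the first run of Baker's method at `N·w`, from the engine output
  obtain ⟨K, hKtop, hbord, r, hr, hrmem⟩ :=
    dichotomy_of_engine hphil L h₂ h₃ hCM κM hrat h𝔟 hss hNw𝔟 (heng _ hNw𝔟 hNw hred)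
  -- by stability, `Lie K = 0`
  have hKbot : K.tangent = ⊥ := by
    by_contra hKbot
    obtain ⟨D, hDtop, hDbot, hDbord⟩ := hss.exists_borderline_rational κM hrat K hKtop hKbot hbord
    exact hst D hDtop hDbot hDbord
  -- so `rN·w` is a period, and `w` has torsion abelian part: the landed second run
  have hrw : ((r * N : ℕ) : ℂ) • w ∈ ker L κM := by
    have := (mem_preimageSubgroup_of_tangent_eq_bot L κM hKbot).mp hrmem
    rwa [smul_smul, ← Nat.cast_mul] at this
  have hrN : 0 < r * N := Nat.mul_pos hr hN
  have hwt : w ∈ AlgTors L κM := mem_AlgTors_of_smul_mem_ker L κM hw hrN hrw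
  obtain ⟨K₂, hK₂top, hK₂bot, hK₂bord⟩ :=
    torsionDichotomy hphil L h₂ h₃ hCM κM hrat h𝔟 hss hw𝔟 hwt hrN hrw hwker
  obtain ⟨D, hDtop, hDbot, hDbord⟩ := hss.exists_borderline_rational κM hrat K₂ hK₂top hK₂bot hK₂bord
  exact hst D hDtop hDbot hDbord

/-! ### The induction over borderline quotients and subgroups -/

/-- **The Semistability Theorem for `M_κ` at ALL algebraic points, at dimension `n`, by strong
induction on `n`** (modulo Philippon's zero estimate and the engine output at all REDUCED algebraic
points of all standard models for `Λ`). The proof of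
`SemistabilityStdOfEngine.mem_ker_of_semistable_card_alg` verbatim, with `mem_ker_of_stable_algR` in
the stable case. [cite: BakerWustholz2007, Thm. 6.15, §6.8 (p. 115: induction over G^* and B ∩ ker π; pp. 116–119)] -/
theorem mem_ker_of_semistable_card_algR (hphil : philippon1986_std) (L : PeriodPair)
    (h₂ : IsAlgebraic ℚ L.g₂) (h₃ : IsAlgebraic ℚ L.g₃) (hCM : ¬ L.HasCM)
    (heng : ∀ (β γ δ : Type) [Fintype β] [Fintype γ] [Fintype δ] [DecidableEq γ] (κM : δ → γ → Kbar)
      (𝔟 : Submodule ℂ (β ⊕ (γ ⊕ δ) → ℂ)), IsKRational Kbar 𝔟 → 𝔟 ≠ ⊤ → Semistable κM 𝔟 →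
      ∀ w ∈ 𝔟, w ∈ Alg L κM → (∀ b, w (iz b) ∈ L.lattice ∨ ∀ s : ℕ, s ≠ 0 → (s : ℂ) * w (iz b) ∉ L.lattice) →
      0 < Module.finrank ℂ 𝔟 → ∀ c : ℝ, 0 < c →
      ∃ (D S T : ℕ) (P : MvPolynomial (Option β × ThetaIdx γ δ) ℂ), 1 ≤ D ∧ 1 ≤ S ∧
        P.IsHomogeneous D ∧ (∃ w', thetaEval L κM P w' ≠ 0) ∧
        (∀ s : ℕ, s ≤ Fintype.card (β ⊕ (γ ⊕ δ)) * S →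
          VanishesAlong 𝔟 (thetaEval L κM P) ((s : ℂ) • w) (Fintype.card (β ⊕ (γ ⊕ δ)) * T + 1)) ∧
        ∀ e m : ℕ, m < Fintype.card (β ⊕ (γ ⊕ δ)) →
          Module.finrank ℂ 𝔟 * (Fintype.card (β ⊕ (γ ⊕ δ)) - m) ≤ e * Fintype.card (β ⊕ (γ ⊕ δ)) →
          c * (D : ℝ) ^ Fintype.card (β ⊕ (γ ⊕ δ)) < (Nat.choose (T + e) e : ℝ) * ((S : ℝ) + 1) * (D : ℝ) ^ m ∧
          (Module.finrank ℂ 𝔟 * (Fintype.card (β ⊕ (γ ⊕ δ)) - m) < e * Fintype.card (β ⊕ (γ ⊕ δ)) →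
            c * (D : ℝ) ^ Fintype.card (β ⊕ (γ ⊕ δ)) < (Nat.choose (T + e) e : ℝ) * (D : ℝ) ^ m))
    (n : ℕ) :
    ∀ (β γ δ : Type) [Fintype β] [Fintype γ] [Fintype δ] (κM : δ → γ → Kbar)
      (𝔟 : Submodule ℂ (β ⊕ (γ ⊕ δ) → ℂ)), Fintype.card (β ⊕ (γ ⊕ δ)) = n →
      IsKRational Kbar 𝔟 → 𝔟 ≠ ⊤ → Semistable κM 𝔟 →
      ∀ w ∈ 𝔟, w ∈ Alg L κM → w ∈ ker L κM := by
  induction n using Nat.strong_induction_on with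
  | _ n ih =>
  intro β γ δ _ _ _ κM 𝔟 hn hrat h𝔟 hss w hw𝔟 hw
  classical
  by_cases hbord : ∃ D : SubgroupData β γ δ κM, D.tangent ≠ ⊤ ∧ D.tangent ≠ ⊥ ∧
      finrank ℂ 𝔟 * (Fintype.card (β ⊕ (γ ⊕ δ)) - finrank ℂ D.tangent) =
        (finrank ℂ 𝔟 - finrank ℂ ↥(𝔟 ⊓ D.tangent)) * Fintype.card (β ⊕ (γ ⊕ δ))
  · -- a borderline `0 ≠ K₀ ≠ M_κ`: induct over `M_κ/K₀` and `K₀`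
    obtain ⟨D₀, hD₀top, hD₀bot, hD₀bord⟩ := hbord
    have hk₀lt : finrank ℂ ↥D₀.tangent < n := by
      have := Submodule.finrank_lt hD₀top; simpa [hn] using this
    -- Step 1: `w ∈ Lie K₀`, through the quotient `M_κ/K₀` at all division points `w/m`
    obtain ⟨Q⟩ := nonempty_quotData D₀
    obtain ⟨hrat', htop', hss'⟩ := Q.transport hrat h𝔟 hss hD₀top hD₀bord
    have hcard' : Fintype.card Q.σ' < n := by
      have hk₀pos : 0 < finrank ℂ ↥D₀.tangent := by
        rw [Nat.pos_iff_ne_zero, Ne, Submodule.finrank_eq_zero]; exact hD₀bot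
      have := Q.card_eq; rw [hn] at this; omega
    have hwD₀ : w ∈ D₀.tangent := by
      refine D₀.mem_tangent_of_forall_exists (L := L) w fun m hm => ?_
      have hwm : (m : ℂ)⁻¹ • w ∈ Alg L κM := inv_natCast_smul_mem_Alg L κM h₂ h₃ hw hm
      have hwm𝔟 : (m : ℂ)⁻¹ • w ∈ 𝔟 := Submodule.smul_mem _ _ hw𝔟
      have hΦ : Q.Φ ((m : ℂ)⁻¹ • w) ∈ ker L Q.κM' :=
        ih _ hcard' (Fin Q.nA) (Fin Q.nC) (Fin Q.nΞ) Q.κM' (𝔟.map Q.Φ) rfl hrat' htop' hss' _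
          (Submodule.mem_map_of_mem hwm𝔟) (Q.Φ_mem_Alg h₂ h₃ hwm)
      obtain ⟨k, hk, hh⟩ := Q.exists_ker_of_Φ_mem_ker hΦ
      refine ⟨k, hk, (m : ℂ)⁻¹ • w - k, hh, ?_⟩
      have hm0 : (m : ℂ) ≠ 0 := by exact_mod_cast hm.ne'
      rw [add_sub_cancel, smul_smul, mul_inv_cancel₀ hm0, one_smul]
    -- Step 2: transport to the subgroup `K₀ = M_κ''`
    obtain ⟨S⟩ := nonempty_subData D₀
    obtain ⟨hratS, htopS, hssS⟩ := S.transport hrat h𝔟 hss hD₀top hD₀bot hD₀bord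
    have hcardS : Fintype.card S.σ' < n := by rw [S.card_eq]; exact hk₀lt
    obtain ⟨w', hw'⟩ := S.exists_eq_ι hwD₀
    have hw'𝔟 : w' ∈ 𝔟.comap S.ι := by show S.ι w' ∈ 𝔟; rw [hw']; exact hw𝔟
    have hw'alg : w' ∈ Alg L S.κS := S.mem_Alg_of_ι h₂ h₃ (by rw [hw']; exact hw)
    have hker' := ih _ hcardS (Fin S.nA) (Fin S.nC) (Fin S.nΞ) S.κS (𝔟.comap S.ι) rfl hratS htopS hssS
      w' hw'𝔟 hw'alg
    rw [← hw']
    exact S.ι_mem_ker hker'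
  · -- `𝔟` is stable: the two runs of Baker's method, the first one at a reduced multiple
    push Not at hbord
    exact mem_ker_of_stable_algR hphil L h₂ h₃ hCM κM hrat h𝔟 hss (fun D h1 h2 => hbord D h1 h2) hw𝔟 hw
      (fun w' hw'𝔟 hw' hred => heng β γ δ κM 𝔟 hrat h𝔟 hss w' hw'𝔟 hw' hred)


end Std

end GaGmE

open GaGmE GaGmE.Std in
/-- **Baker–Wüstholz's Semistability Theorem for the explicit group varieties `M_κ`, every proper
semistable `ℚ̄`-rational `𝔟`, at EVERY algebraic point, follows from Philippon's zero estimate on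
`M_κ`.** The constructive half (Baker's method at a general algebraic point: the field and heights of
`BakerFieldG`, the Siegel and Liouville steps of `BakerSiegelG`, the extrapolation and the lower
bound for the base theta function of `ThetaBaseLowerBoundG`/`BakerNewPointsG`, the exponential
parameters of `BakerNumericsG`) is proved in the tree; the closing half is `dichotomy_of_engine` and
the landed torsion run. The discharge `semistabilityTheorem_std_holds` is exactly
`semistabilityTheorem_std_of_philippon philippon1986_std_holds` once the upstream named fact is
proved. [cite: BakerWustholz2007, Thm. 6.15 (Semistability Theorem), §6.8 (pp. 115–119)] [cite: Philippon1986, Thm 2.1] -/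
theorem semistabilityTheorem_std_of_philippon (hphil : philippon1986_std) : semistabilityTheorem_std := by
  intro L h₂ h₃ hCM β γ δ _ _ _ κM 𝔟 hrat h𝔟 hss w hw𝔟 hw
  classical
  refine mem_ker_of_semistable_card_algR hphil L h₂ h₃ hCM ?_ _ β γ δ κM 𝔟 rfl hrat h𝔟 hss w hw𝔟 hw
  intro β' γ' δ' _ _ _ _ κM' 𝔟' hrat' h𝔟' _ w' hw'𝔟 hw' hred hpos c hc
  classical
  exact engine_of_reduced L h₂ h₃ κM' hrat' h𝔟' hw'𝔟 hw' hred hc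

open GaGmE GaGmE.Std in
/-- **The analytic subgroup theorem for `𝔾ₐ × 𝔾ₘ^ι × (E♮)^κ` from Philippon's zero estimate**
(through the landed reduction `analyticSubgroupTheorem_GaGmE_of_std`).
[cite: BakerWustholz2007, Thm. 6.1 and Thm. 6.15] [cite: Philippon1986, Thm 2.1] -/
theorem analyticSubgroupTheorem_GaGmE_of_philippon (hphil : philippon1986_std) : analyticSubgroupTheorem_GaGmE :=
  analyticSubgroupTheorem_GaGmE_of_std (semistabilityTheorem_std_of_philippon hphil)

/-- **Baker–Wüstholz's Semistability Theorem holds for the explicit group varieties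
`M_κ = 𝔾ₘ^β × P_κ`** (`P_κ` the push-out of `(E♮)^γ` along `κ : (ℚ̄^γ) → ℚ̄^δ`, `E` with
`g₂, g₃ ∈ ℚ̄` and without complex multiplication): for every proper `ℚ̄`-rational subspace
`𝔟 ⊊ Lie M_κ` that is semistable in `M_κ`, every `w ∈ 𝔟_ℂ` with `exp_{M_κ}(w)` algebraic lies in
`ker exp_{M_κ}` — i.e. the proper semistable analytic subgroup `B = exp(𝔟_ℂ)` has `B(ℚ̄)` reduced
to the image of the kernel. PROVED: `semistabilityTheorem_std_of_philippon` (Baker's method at a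
general algebraic point, this file and its imports) applied to Philippon's zero estimate
`philippon1986_std_holds`.
[cite: BakerWustholz2007, Thm. 6.15 (Semistability Theorem); §6.7; §6.8 (pp. 115–119)] [cite: Philippon1986, Thm. 2.1] -/
theorem semistabilityTheorem_std_holds : semistabilityTheorem_std :=
  semistabilityTheorem_std_of_philippon philippon1986_std_holds

end Literature.NumberTheory.Transcendental

end
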